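import Literature.MathematicalPhysics.QuantumFieldTheory.OSContinuationBounds
import HarnessLib

/-!
# Gluing on the base of one continuation step of OS II, and the explicit constants of the levels

Topic `Literature/MathematicalPhysics/QuantumFieldTheory`; support file (all proved; explicit
constants as definitions; no named facts) for the discharge of (A1)
`OS1975_exists_timeContinuation`. Osterwalder–Schrader II (Comm. Math. Phys. 42 (1975)), Ch. V.2,
p. 294 with Ch. VI.2 (6.28): the **label-free** ingredients of the induction step
(A_N) ⇒ (A_{N+1}) shared by the labelled driver `OSLabelledStep`:

* set algebra of argument regions (`argRegion_mono`, `_union`, `_iUnion`, `_inter`, `_empty`),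
  `osBaseC_succ_zero`, `stepBase_eq_union_iUnion`;
* `exists_glue` — **gluing on the base of the step**: `S k` holomorphic on the region of
  `c_k^{(N+1)}` and piece functions `F p` holomorphic on the regions of the pieces, all equal to
  `S k` at the positive real points, glue to one holomorphic function on the region of
  `stepBase N k` (identity theorem from the positive real points on the pairwise intersections);
* the explicit constants of the new level and of all levels: `stepExp`, `glueConst`, `succExp`,
  `succConst` (through the chosen compact covers of `OSContinuationGeometry` and the explicit
  maximum principle of `BochnerExplicitBounds`), their iterates `iterConst`, and, for a compact part
  `K` of the cube, the level `cubeLevel` at which `K ⊆ c_k^{(N)}` (Lemma 5.2) with the constants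
  `cubeConst`, `cubeExp` of the continuation there. They are functions of the input constants and
  of the data-independent geometry only, whence uniformity over families (labels).

## References

* K. Osterwalder, R. Schrader, *Axioms for Euclidean Green's functions II*, Comm. Math. Phys. 42
  (1975) 281–305, Ch. V.2 pp. 294–296, Lemma 5.2, Ch. VI.2 (6.15), (6.28). [OsterwalderSchraderCMP1975]
-/

noncomputable section

open Metric Set Filter Complex
open scoped Topology ComplexConjugate InnerProductSpace Pointwise

namespace Literature.MathematicalPhysics.QuantumFieldTheory.OSEnvelope

open Literature.Analysis.Complex Literature.MathematicalPhysics.QuantumFieldTheory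

/-! ### Set algebra of argument regions -/

section Regions

variable {k : ℕ}

/-- Argument regions are monotone in the base. [folklore] -/
theorem argRegion_mono {B B' : Set (Fin k → ℝ)} (h : B ⊆ B') : argRegion B ⊆ argRegion B' :=
  fun _ hZ => ⟨hZ.1, h hZ.2⟩

/-- Argument region of a union. [folklore] -/
theorem argRegion_union (B B' : Set (Fin k → ℝ)) : argRegion (B ∪ B') = argRegion B ∪ argRegion B' := by
  ext Z; simp only [mem_argRegion, mem_union]; tauto

/-- Argument region of an indexed union. [folklore] -/
theorem argRegion_iUnion {ι : Type*} [Nonempty ι] (B : ι → Set (Fin k → ℝ)) :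
    argRegion (⋃ i, B i) = ⋃ i, argRegion (B i) := by
  ext Z; simp only [mem_argRegion, mem_iUnion]
  constructor
  · rintro ⟨h1, i, hi⟩; exact ⟨i, h1, hi⟩
  · rintro ⟨i, h1, hi⟩; exact ⟨h1, i, hi⟩

/-- Argument region of an intersection. [folklore] -/
theorem argRegion_inter (B B' : Set (Fin k → ℝ)) : argRegion (B ∩ B') = argRegion B ∩ argRegion B' := by
  ext Z; simp only [mem_argRegion, mem_inter_iff]; tauto

/-- The argument region of the empty base is empty. [folklore] -/
theorem argRegion_empty : argRegion (∅ : Set (Fin k → ℝ)) = ∅ := by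
  ext Z; simp [mem_argRegion]

/-- The bases of positive level are empty for `k = 0`. [folklore] -/
theorem osBaseC_succ_zero (N : ℕ) : osBaseC (N + 1) 0 = ∅ := by
  rw [osBaseC_succ]
  have : osGen (osBaseD N) 0 = ∅ := by
    ext v; simp only [osGen, mem_setOf_eq, mem_empty_iff_false, iff_false]
    rintro ⟨p, -⟩; exact p.elim0
  rw [this, convexHull_empty]

/-- The base of the step as the old base and the pieces. [folklore] -/
theorem stepBase_eq_union_iUnion (N k : ℕ) :
    stepBase N k = osBaseC (N + 1) k ∪ ⋃ p : Fin k, osPiece (N + 1) k p := by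
  rw [stepBase, osGen_eq_iUnion_osPiece]

end Regions

/-! ### Gluing the old function and the piece functions -/

section Glue

variable {N k : ℕ}

/-- **Gluing on the base of the step.** Given `S k` holomorphic on the region of `c_k^{(N+1)}` and
piece functions `F p` holomorphic on the regions of the pieces, all agreeing with `S k` at the
positive real points, there is one holomorphic function on the region of `stepBase N k` equal to
`S k` on the old region and to `F p` on the region of the piece `p` (identity theorem from the
positive real points on the pairwise intersections, which are regions over convex open sets
containing `0`). [cite: OsterwalderSchraderCMP1975, Ch. V.2 p. 294] -/
theorem exists_glue {Sk : (Fin k → ℂ) → ℂ} (hSk : DifferentiableOn ℂ Sk (argRegion (osBaseC (N + 1) k)))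
    {F : Fin k → (Fin k → ℂ) → ℂ} (hF : ∀ p, DifferentiableOn ℂ (F p) (argRegion (osPiece (N + 1) k p)))
    (hFreal : ∀ p (ρ : Fin k → ℝ), (∀ i, 0 < ρ i) → F p (fun i => (ρ i : ℂ)) = Sk (fun i => (ρ i : ℂ))) :
    ∃ G : (Fin k → ℂ) → ℂ, DifferentiableOn ℂ G (argRegion (stepBase N k)) ∧
      EqOn G Sk (argRegion (osBaseC (N + 1) k)) ∧ ∀ p, EqOn G (F p) (argRegion (osPiece (N + 1) k p)) := by
  classical
  -- the family indexed by `Option (Fin k)`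
  set B : Option (Fin k) → Set (Fin k → ℝ) := fun o => o.elim (osBaseC (N + 1) k) fun p => osPiece (N + 1) k p
    with hB
  set Fn : Option (Fin k) → (Fin k → ℂ) → ℂ := fun o => o.elim Sk fun p => F p with hFn
  have hBo : ∀ o, IsOpen (B o) := by
    rintro (_ | p); exacts [isOpen_osBaseC_succ N k, isOpen_osPiece_succ N k p]
  have hBc : ∀ o, Convex ℝ (B o) := by
    rintro (_ | p); exacts [isOSBaseFamily_osBase.convex _ _, convex_osPiece _ _ p]
  have hBcube : ∀ o, B o ⊆ {v | ∀ i, |v i| < Real.pi / 2} := by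
    rintro (_ | p); exacts [osBaseC_subset_cube _ _, osPiece_subset_cube _ _ p]
  have hFd : ∀ o, DifferentiableOn ℂ (Fn o) (argRegion (B o)) := by
    rintro (_ | p); exacts [hSk, hF p]
  have hFr : ∀ o (ρ : Fin k → ℝ), (∀ i, 0 < ρ i) → Fn o (fun i => (ρ i : ℂ)) = Sk (fun i => (ρ i : ℂ)) := by
    rintro (_ | p) ρ hρ; exacts [rfl, hFreal p ρ hρ]
  rcases Nat.eq_zero_or_pos k with rfl | hk
  · -- `k = 0`: everything is empty
    refine ⟨Sk, ?_, fun _ _ => rfl, fun p => p.elim0⟩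
    rw [stepBase, osBaseC_succ_zero, empty_union]
    have : osGen (osBaseD (N + 1)) 0 = ∅ := by
      ext v; simp only [osGen, mem_setOf_eq, mem_empty_iff_false, iff_false]
      rintro ⟨p, -⟩; exact p.elim0
    rw [this, argRegion_empty]
    exact differentiableOn_empty
  have hB0 : ∀ o, (0 : Fin k → ℝ) ∈ B o := by
    rintro (_ | p); exacts [zero_mem_osBaseC _ hk, zero_mem_osPiece _ _ p]
  -- pairwise agreement
  have hagree : ∀ i j, EqOn (Fn i) (Fn j) (argRegion (B i) ∩ argRegion (B j)) := by
    intro i j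
    rw [← argRegion_inter]
    refine eqOn_argRegion_of_eqOn_posReal ((hBo i).inter (hBo j)) ((hBc i).inter (hBc j))
      ⟨hB0 i, hB0 j⟩ (fun v hv => hBcube i hv.1)
      ((hFd i).mono (argRegion_mono inter_subset_left))
      ((hFd j).mono (argRegion_mono inter_subset_right)) fun η hη => ?_
    rw [hFr i η hη, hFr j η hη]
  obtain ⟨G, hGd, hGi⟩ := exists_differentiableOn_iUnion_of_eqOn_inter
    (fun o => argRegion (B o)) Fn (fun o => isOpen_argRegion (hBo o)) hFd hagree
  refine ⟨G, ?_, hGi none, fun p => hGi (some p)⟩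
  have hset : argRegion (stepBase N k) = ⋃ o, argRegion (B o) := by
    ext Z
    simp only [mem_iUnion]
    constructor
    · intro hZ
      rcases hZ.2 with h | h
      · exact ⟨none, hZ.1, h⟩
      · rw [osGen_eq_iUnion_osPiece] at h
        obtain ⟨p, hp⟩ := mem_iUnion.1 h
        exact ⟨some p, hZ.1, hp⟩
    · rintro ⟨(_ | p), h⟩
      · exact ⟨h.1, Or.inl h.2⟩
      · refine ⟨h.1, Or.inr ?_⟩
        rw [osGen_eq_iUnion_osPiece]; exact mem_iUnion.2 ⟨p, h.2⟩
  rw [hset]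
  exact hGd

end Glue

/-! ### The explicit constants -/

/-- **The exponent of the step** at `k`: the maximum of the old exponent and the piece exponents. [folklore] -/
def stepExp (pfun : ℕ → ℕ) (k : ℕ) : ℕ :=
  max (pfun k) (Finset.univ.sup fun p : Fin k => pieceExp pfun k p)

open Classical in
/-- **The constant of the glued function on a compact part `K` of the base of the step**: through
a (chosen) cover of `K` by compact parts of the old base and of the pieces, and the (chosen)
margins of the free arguments. [folklore] -/
def glueConst (N : ℕ) (CT : ℝ) (Cfun : (k : ℕ) → Set (Fin k → ℝ) → ℝ) (pfun : ℕ → ℕ) (k : ℕ)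
    (K : Set (Fin k → ℝ)) : ℝ :=
  if h : IsCompact K ∧ K ⊆ stepBase N k then
    max (Cfun k (exists_compact_cover_stepBase N k h.1 h.2).choose) 0 +
      ∑ p : Fin k, max (pieceConst CT Cfun pfun k p
        ((exists_compact_cover_stepBase N k h.1 h.2).choose_spec.choose p)
        (Real.cos (exists_abs_apply_le_of_isCompact
          ((exists_compact_cover_stepBase N k h.1 h.2).choose_spec.choose_spec.2.2.1 p)
          ((exists_compact_cover_stepBase N k h.1 h.2).choose_spec.choose_spec.2.2.2.1 p)).choose)) 0
  else 0

/-- **The exponent of the new level.** [folklore] -/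
def succExp (pfun : ℕ → ℕ) (k : ℕ) : ℕ := stepExp pfun k * k * k

open Classical in
/-- **The constant of the new level on a compact part `K` of `c_k^{(N+2)}`**: shrink `K` into
`t · c_k^{(N+2)}` (`t < 1` chosen), bound the glued function on `t · closure (stepBase)`, and apply
the explicit maximum principle. [folklore] -/
def succConst (N : ℕ) (CT : ℝ) (Cfun : (k : ℕ) → Set (Fin k → ℝ) → ℝ) (pfun : ℕ → ℕ) (k : ℕ)
    (K : Set (Fin k → ℝ)) : ℝ :=
  if h : IsCompact K ∧ K ⊆ osBaseC (N + 2) k ∧ 0 < k then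
    glueConst N CT Cfun pfun k
        ((exists_lt_one_subset_smul (isOSBaseFamily_osBase.convex (N + 2) k)
            (isOpen_osBaseC_succ (N + 1) k) (zero_mem_osBaseC _ h.2.2) h.1 h.2.1).choose •
          closure (stepBase N k)) *
      (2 : ℝ) ^ (k * stepExp pfun k) * (2 / Real.cos 1) ^ (stepExp pfun k * k * (2 * k + 1) * k)
  else 0

/-! ### The constants of all levels, and of the continuation on compact parts of the cube -/

/-- **The constants of all levels**, by iterating `succConst`/`succExp`. [folklore] -/
def iterConst (N₀ : ℕ) (CT : ℝ) (Cfun : (k : ℕ) → Set (Fin k → ℝ) → ℝ) (pfun : ℕ → ℕ) :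
    ℕ → ((k : ℕ) → Set (Fin k → ℝ) → ℝ) × (ℕ → ℕ)
  | 0 => (Cfun, pfun)
  | n + 1 => (succConst (N₀ + n) CT (iterConst N₀ CT Cfun pfun n).1 (iterConst N₀ CT Cfun pfun n).2,
      succExp (iterConst N₀ CT Cfun pfun n).2)

open Classical in
/-- **The level at which a compact part of the cube is reached** (data-independent). [folklore] -/
def cubeLevel (N k : ℕ) (K : Set (Fin k → ℝ)) : ℕ :=
  if h : IsCompact K ∧ K ⊆ {v | ∀ i, |v i| < Real.pi / 2} ∧ 0 < k then
    Nat.find (p := fun n => K ⊆ osBaseC (N + n + 1) k) (by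
      obtain ⟨k', hk'⟩ : ∃ k', k = k' + 1 := ⟨k - 1, by have := h.2.2; omega⟩
      subst hk'
      have hcube : ⋃ n, osBaseC (N + n + 1) (k' + 1) = {v | ∀ i, |v i| < Real.pi / 2} := by
        apply Subset.antisymm (iUnion_subset fun n => osBaseC_subset_cube _ _)
        rw [← iUnion_osBaseC k']
        refine iUnion_subset fun M => ?_
        exact (osBaseC_mono (Nat.succ_pos k') (show M ≤ N + M + 1 by omega)).trans
          (subset_iUnion (fun n => osBaseC (N + n + 1) (k' + 1)) M)
      have hdir : Directed (· ⊆ ·) fun n => osBaseC (N + n + 1) (k' + 1) :=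
        Monotone.directed_le fun a b hab => osBaseC_mono (Nat.succ_pos k') (by omega)
      exact h.1.elim_directed_cover (fun n => osBaseC (N + n + 1) (k' + 1))
        (fun n => isOpen_osBaseC_succ _ _) (by rw [hcube]; exact h.2.1) hdir)
  else 0

/-- The defining property of `cubeLevel`. [folklore] -/
theorem subset_osBaseC_cubeLevel {N k : ℕ} {K : Set (Fin k → ℝ)} (hKc : IsCompact K)
    (hK : K ⊆ {v | ∀ i, |v i| < Real.pi / 2}) (hk : 0 < k) :
    K ⊆ osBaseC (N + cubeLevel N k K + 1) k := by
  classical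
  rw [cubeLevel, dif_pos ⟨hKc, hK, hk⟩]
  exact Nat.find_spec (p := fun n => K ⊆ osBaseC (N + n + 1) k) _

/-- **The constants of the continuation on the whole product of right half-planes**, on a compact
part `K` of the cube: those of the level at which `K` is reached. [folklore] -/
def cubeConst (N : ℕ) (CT : ℝ) (Cfun : (k : ℕ) → Set (Fin k → ℝ) → ℝ) (pfun : ℕ → ℕ) (k : ℕ)
    (K : Set (Fin k → ℝ)) : ℝ :=
  (iterConst N CT Cfun pfun (cubeLevel N k K)).1 k K

/-- The exponents of the continuation on a compact part `K` of the cube. [folklore] -/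
def cubeExp (N : ℕ) (CT : ℝ) (Cfun : (k : ℕ) → Set (Fin k → ℝ) → ℝ) (pfun : ℕ → ℕ) (k : ℕ)
    (K : Set (Fin k → ℝ)) : ℕ :=
  (iterConst N CT Cfun pfun (cubeLevel N k K)).2 k

end Literature.MathematicalPhysics.QuantumFieldTheory.OSEnvelope
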